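import Summits.BirchSwinnertonDyer.BirchSwinnertonDyer.Theorems.ResidualThetaTransportAtTwoResidualSignedLambdaLowerCMAtTwoMazurTateValuesTransfer
import Summits.BirchSwinnertonDyer.BirchSwinnertonDyer.Theorems.ResidualThetaTransportAtTwoResidualSignedLambdaLowerCMAtTwoColemanPlusOfDatum
import Summits.BirchSwinnertonDyer.BirchSwinnertonDyer.Theorems.ResidualThetaTransportAtTwoResidualSignedLambdaLowerCMAtTwoColemanPlusHomTwoCoeff
import HarnessLib

/-!
# Station (R) from MTV_Λ AT A HANDED plus Honda datum: H1 packaged as a pinned `ℤ₂`-column (`exists_colemanPlusHom_two_of_datum`) and the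
# relay composed with the ∀-discharge (`hERL_of_mazurTateValues_at_datum`)

Route `ResidualThetaTransportAtTwo` (RTT), crux RSL_g `ResidualSignedLambdaLowerCMAtTwo` (stmt-BirchSwinnertonDyer-22608), line `onepair` v3f,
station (R) `stub_kzgValueRelation` of the KZ_g interior (stmt-BirchSwinnertonDyer-24105 hold-opening). Seat `bsd-wall-tp2-p2x-w2` g21 (width seat;
`--supports`, closes nothing). THEOREMS ONLY (no definition, no named fact, no instance, no `sorry`); zero new mathematics (packaging of landed
theorems). BSD is not proved by any of this; RSL_g / KZ_g stay OPEN.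

WHAT (stub-critic STUB-PLAN rev 27.1 §0.8 S143 / §0.9 S146 — «H1 → `exists_unit_mul_col_of_pin` → T5 → T8 → T6, `μt` FIXED»):
* §1 **`exists_colemanPlusHom_two_of_datum`** — H1 (`SignedColemanImage.colemanPlus_coeff_two_of_datum`, p719043) packaged by the landed
  `SignedColemanImage.exists_linearMap_of_plusCongr`: for a HANDED datum `(g, d)` with (L), (TR), (GEN), (GEN₀) at `v ∋ 2` and every `𝒪` finite free
  over `ℤ₂`, an `𝒪`-LINEAR plus Coleman map `col` along `(g, d)` with (a) the congruences, (b) pinning, (c) onto, (d) kernel `ann(E⁺_∞)` — the exact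
  input shape of `OnePair.OnePairPins.exists_unit_mul_col_of_pin` / `MazurTateValuesRelay.hMT_of_hMT_along` at `𝒪 := ℤ₂`.
* §2 **`hERL_of_mazurTateValues_at_datum`** — station (R) at `D := μt` BY NAME from MTV_Λ along ONE handed plus Honda datum at `π.v`:
  `∃ ν u, ν ≠ 0 ∧ IsUnit u ∧ C ν · e(𝒸 z) = μt · (L⁻ · u)` (= `hERL_of_mazurTateValues_along` ∘ §1 at `ℤ₂`). What remains of station (R) after this
  file is I1's M-content only: child A's valued class ⟹ MTV_Λ along the displayed formal datum (S143 MTV(c); PRINT-adjacent).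

References: [Kato2004Asterisque] Thm. 12.5 (1) (p. 221); [Kobayashi2003] Thm. 6.2 (6.13), Prop. 8.18–8.25; [Sprung2012] Thm. 2.2 (2′), Prop. 7.3;
[Pollack2003] Prop. 6.18.
-/

set_option autoImplicit false
-- D-0017: single-problem summit, so `Summit.BirchSwinnertonDyer.BirchSwinnertonDyer.…` repeats a namespace BY DESIGN.
set_option linter.dupNamespace false

noncomputable section

open scoped Classical Polynomial

namespace Summit.BirchSwinnertonDyer.BirchSwinnertonDyer.Theorems.ThetaTransport.MazurTateValuesRelay

open Polynomial (X C)
open Literature.NumberTheory.EllipticCurves Literature.NumberTheory.EllipticCurves.ModularForms CongruenceSubgroup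
  Literature.NumberTheory.Automorphic
  Summit.BirchSwinnertonDyer.BirchSwinnertonDyer.Theorems.PollackPairK
  Literature.NumberTheory.EllipticCurves.GreenbergSelmer Literature.NumberTheory.GaloisRepresentations
  NumberField IsDedekindDomain Field Kobayashi2003 Rat.HeightOneSpectrum
  Literature.NumberTheory.EllipticCurves.Sprung2012 Literature.NumberTheory.EllipticCurves.Rank1Residual
  Summit.BirchSwinnertonDyer.BirchSwinnertonDyer.Theorems.OnePair
  Summit.BirchSwinnertonDyer.BirchSwinnertonDyer.Theorems.SignedColemanImage

/-! ## §1 H1 packaged: the pinned `𝒪`-linear plus Coleman map along a HANDED datum -/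

section Datum

variable (W : WeierstrassCurve ℚ) [W.IsElliptic] [W.IsGloballyMinimal]

set_option maxHeartbeats 800000 in
/-- **`Col⁺ ⊗ 𝒪` along a HANDED plus Honda datum, as a pinned linear map.** For `W/ℚ` globally minimal with `GoodSS W 2`, cyclotomic `κ`, `v ∋ 2`,
a local lift `g` of the topological generator, a family `d` with (L), (TR), (GEN), (GEN₀), and any proof `hdA` that the orbit lies in the tower points:
for EVERY `𝒪` finite free over `ℤ₂` and a domain there is an `𝒪`-LINEAR `col : Hom(E(ℚ_{2,∞}·ℚ_v), 𝒪) → 𝒪⟦T⟧` along `(g, d)` which (a) satisfies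
the plus congruences, (b) is pinned by them, (c) is onto, (d) has kernel `ann(E⁺_∞)`. (`colemanPlus_coeff_two_of_datum` ∘ `exists_linearMap_of_plusCongr`.)
[cite: Kobayashi2003, Thm. 6.2 (6.13), Prop. 8.12, Prop. 8.18–8.23] [cite: Sprung2012, Thm. 2.2 (2′), Prop. 7.3, Def. 5.9] [cite: Sprung2017, Cor. 4.4] -/
theorem exists_colemanPlusHom_two_of_datum (hss : GoodSS W 2) (κ : ZpExtension ℚ 2) (hκ : κ.IsCyclotomic)
    (v : HeightOneSpectrum (𝓞 ℚ)) (hv : (2 : 𝓞 ℚ) ∈ v.asIdeal)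
    (g : Field.absoluteGaloisGroup (v.adicCompletion ℚ)) (hg : κ.IsTopGenerator (resGalOfEmb (closureEmb (K := ℚ) (v.adicCompletion ℚ)) g))
    (d : ℕ → localPoints W (v.adicCompletion ℚ))
    (hd : ∀ m, d m ∈ localLayerPointsOfEmb κ (closureEmb (K := ℚ) (v.adicCompletion ℚ)) W m)
    (htr : ∀ m, localTraceOfEmb κ (closureEmb (K := ℚ) (v.adicCompletion ℚ)) W (m + 1) (m + 2) (d (m + 2)) = -d m)
    (hgen : ∀ m : ℕ, 1 ≤ m → ∀ P ∈ localLayerPointsOfEmb κ (closureEmb (K := ℚ) (v.adicCompletion ℚ)) W m,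
      ∃ B ∈ AddSubgroup.closure (Set.range fun σ : Field.absoluteGaloisGroup (v.adicCompletion ℚ) ↦ σ • d m),
        ∃ P' ∈ localLayerPointsOfEmb κ (closureEmb (K := ℚ) (v.adicCompletion ℚ)) W (m - 1),
        ∃ R ∈ localLayerPointsOfEmb κ (closureEmb (K := ℚ) (v.adicCompletion ℚ)) W m, P = B + P' + 2 • R)
    (hgen0 : ∀ P ∈ localLayerPointsOfEmb κ (closureEmb (K := ℚ) (v.adicCompletion ℚ)) W 0,
      ∃ a : ℤ, ∃ R ∈ localLayerPointsOfEmb κ (closureEmb (K := ℚ) (v.adicCompletion ℚ)) W 0, P = a • d 0 + 2 • R)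
    (hdA : ∀ m j, g ^ j • d m ∈ Sprung2012.localTowerPointsOfEmb κ (closureEmb (K := ℚ) (v.adicCompletion ℚ)) W)
    (O : Type) [CommRing O] [IsDomain O] [Algebra ℤ_[2] O] [Module.Free ℤ_[2] O] [Module.Finite ℤ_[2] O] :
    ∃ col : (Sprung2012.localTowerPointsOfEmb κ (closureEmb (K := ℚ) (v.adicCompletion ℚ)) W →+ O) →ₗ[O] PowerSeries O,
      (∀ (z : Sprung2012.localTowerPointsOfEmb κ (closureEmb (K := ℚ) (v.adicCompletion ℚ)) W →+ O) (m : ℕ),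
        (((cyclotomicOmega 2 (2 * m)).map (Int.castRingHom O) : O[X]) : PowerSeries O) ∣
          ((∑ j ∈ Finset.range (2 ^ (2 * m)), Polynomial.C (z ⟨g ^ j • d (2 * m), hdA (2 * m) j⟩) * (Polynomial.X + 1) ^ j : O[X]) :
              PowerSeries O) +
            (-1 : PowerSeries O) ^ m * (((cyclotomicOmegaMinus 2 (2 * m)).map (Int.castRingHom O) : O[X]) : PowerSeries O) * col z) ∧
      (∀ (z : Sprung2012.localTowerPointsOfEmb κ (closureEmb (K := ℚ) (v.adicCompletion ℚ)) W →+ O) (L : PowerSeries O),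
        (∀ m : ℕ, (((cyclotomicOmega 2 (2 * m)).map (Int.castRingHom O) : O[X]) : PowerSeries O) ∣
          ((∑ j ∈ Finset.range (2 ^ (2 * m)), Polynomial.C (z ⟨g ^ j • d (2 * m), hdA (2 * m) j⟩) * (Polynomial.X + 1) ^ j : O[X]) :
              PowerSeries O) +
            (-1 : PowerSeries O) ^ m * (((cyclotomicOmegaMinus 2 (2 * m)).map (Int.castRingHom O) : O[X]) : PowerSeries O) * L) →
        L = col z) ∧
      Function.Surjective col ∧
      (∀ z : Sprung2012.localTowerPointsOfEmb κ (closureEmb (K := ℚ) (v.adicCompletion ℚ)) W →+ O,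
        col z = 0 ↔ ∀ (n : ℕ) (x : localPoints W (v.adicCompletion ℚ))
          (hx : x ∈ signedLocalPoints κ (v.adicCompletion ℚ) W 1 n),
          z ⟨x, Sprung2012.localLayerPointsOfEmb_le_localTowerPointsOfEmb κ _ W n (signedLocalPointsOfEmb_le κ _ W 1 n hx)⟩ = 0) := by
  obtain ⟨hdA₀, -, -, -, -, hO⟩ := colemanPlus_coeff_two_of_datum W hss κ hκ v hv g hg d hd htr hgen hgen0
  obtain ⟨hex, honto, hker⟩ := hO O
  obtain ⟨col, hcong, hpin, hkerc, hsurj⟩ := exists_linearMap_of_plusCongr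
    (fun m j ↦ (⟨g ^ j • d (2 * m), hdA (2 * m) j⟩ : Sprung2012.localTowerPointsOfEmb κ (closureEmb (K := ℚ) (v.adicCompletion ℚ)) W))
    (fun m ↦ 2 ^ (2 * m)) (fun m ↦ (((cyclotomicOmega 2 (2 * m)).map (Int.castRingHom O) : O[X]) : PowerSeries O))
    (fun m ↦ (((cyclotomicOmegaMinus 2 (2 * m)).map (Int.castRingHom O) : O[X]) : PowerSeries O)) (fun m ↦ (-1 : PowerSeries O) ^ m)
    (fun z ↦ ∀ (n : ℕ) (x : localPoints W (v.adicCompletion ℚ)) (hx : x ∈ signedLocalPoints κ (v.adicCompletion ℚ) W 1 n),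
      z ⟨x, Sprung2012.localLayerPointsOfEmb_le_localTowerPointsOfEmb κ _ W n (signedLocalPointsOfEmb_le κ _ W 1 n hx)⟩ = 0)
    (fun _ _ _ ↦ rfl) hex hker
  exact ⟨col, hcong, hpin, hsurj honto, hkerc⟩

end Datum

/-! ## §2 Station (R) from MTV_Λ along one HANDED plus Honda datum -/

section AtDatum

variable {M : ℕ} {g : CuspForm (Gamma0 M) 2} {ι : coeffField g →+* PadicAlgCl 2} {Ω : ℂ}
  {W : WeierstrassCurve ℚ} [W.IsElliptic] {κ : ZpExtension ℚ 2} {γ : absoluteGaloisGroup ℚ}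
  {S₀ : Finset (HeightOneSpectrum (𝓞 ℚ))} {n : ℕ} {ρ : FramedGaloisRep ℚ ↥(padicCoeffIntegers (Set.range ι)) 2}
  {Θ : ∀ v : HeightOneSpectrum (𝓞 ℚ), ((2 : ℕ) : 𝓞 ℚ) ∈ v.asIdeal →
    (Cofree ρ ↥(padicCoeffField (Set.range ι)) ≃+ (Fin n → ↥(W.geomPrimaryTorsion 2)))}
  {hΘ : ∀ v hv (δ : absoluteGaloisGroup (v.adicCompletion ℚ)) m i,
    Θ v hv (resGalOfEmb (closureEmb (K := ℚ) (v.adicCompletion ℚ)) δ • m) i =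
      resGalOfEmb (closureEmb (K := ℚ) (v.adicCompletion ℚ)) δ • Θ v hv m i}
  {I : Kato2004.IwasawaH1DataCoeff (FramedGaloisRep.toGaloisRep ρ) 2 κ γ}
  {Sg : AddSubgroup (subgroupH1 κ.kerSubgroup (Cofree ρ ↥(padicCoeffField (Set.range ι))))}
  [Module ↥(padicCoeffIntegers (Set.range ι)) ↥Sg]

set_option maxHeartbeats 1600000 in
/-- **STATION (R) FROM MTV_Λ AT A HANDED DATUM (S143's mechanical part, PROVED end to end).** For `W/ℚ` globally minimal with `GoodSS W 2`,
cyclotomic `κ`, a pin bundle `π`, `z ∈ 𝐇¹`, a Pollack pair `(L⁺, L⁻)`, `e : ℤ₂⟦X⟧ⁿ ≃+ Λ_𝒪` additive and `map ι`-semilinear, a NAMED multiplier `μt`, and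
ONE plus Honda datum `(g_c, d_c)` at `π.v` with (L), (TR), (GEN), (GEN₀) (e.g. the displayed formal datum of `plusHondaSystemTwo_adicCompletion_withLog`
with `g_c` from `exists_isTopGenerator_resGalOfEmb_adicCompletion`): IF MTV_Λ holds at `μt` ALONG `(g_c, d_c)` — `∃ ν ≠ 0, w ∈ Λ_𝒪ˣ, ∀ m ∃ k q,
2^k·(ι_Λ μt·θ_{2m}(g)^ι − ι_Λ(C ν·w·e(P⃗^{c}_{2m}(z)))) = ω_{2m}·ι_Λ q` — THEN `∃ ν ≠ 0, u ∈ Λ_𝒪ˣ, C ν · e(𝒸 z) = μt · (L⁻ · u)` (station (R) at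
`D := μt`). [cite: Kato2004Asterisque, Thm. 12.5 (1) (p. 221)] [cite: Kobayashi2003, Thm. 6.2, (8.23), Prop. 8.25] [cite: Pollack2003, Prop. 6.18] -/
theorem hERL_of_mazurTateValues_at_datum [W.IsGloballyMinimal] [FiniteDimensional ℚ_[2] (padicCoeffField (Set.range ι))]
    (hss : GoodSS W 2) (hκ : κ.IsCyclotomic)
    (π : OnePairPins (Set.range ι) W κ γ S₀ n ρ Θ hΘ I Sg) (z : I.H)
    {Lp Lm : IwasawaAlgebraO (Set.range ι)} (hL : IsPollackPairK g ι Ω Lp Lm)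
    (e : (Fin n → PowerSeries ℤ_[2]) ≃+ IwasawaAlgebraO (Set.range ι))
    (he : ∀ (r : PowerSeries ℤ_[2]) (t : Fin n → PowerSeries ℤ_[2]),
      e (r • t) = PowerSeries.map (padicIntToCoeffIntegers (Set.range ι)) r * e t)
    (μt : IwasawaAlgebraO (Set.range ι))
    -- the handed plus Honda datum at `π.v`
    (gc : absoluteGaloisGroup (π.v.adicCompletion ℚ)) (hgc : κ.IsTopGenerator (resGalOfEmb (closureEmb (K := ℚ) (π.v.adicCompletion ℚ)) gc))
    (dc : ℕ → localPoints W (π.v.adicCompletion ℚ))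
    (hdc : ∀ m, dc m ∈ localLayerPointsOfEmb κ (closureEmb (K := ℚ) (π.v.adicCompletion ℚ)) W m)
    (htrc : ∀ m, localTraceOfEmb κ (closureEmb (K := ℚ) (π.v.adicCompletion ℚ)) W (m + 1) (m + 2) (dc (m + 2)) = -dc m)
    (hgenc : ∀ m : ℕ, 1 ≤ m → ∀ P ∈ localLayerPointsOfEmb κ (closureEmb (K := ℚ) (π.v.adicCompletion ℚ)) W m,
      ∃ B ∈ AddSubgroup.closure (Set.range fun σ : Field.absoluteGaloisGroup (π.v.adicCompletion ℚ) ↦ σ • dc m),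
        ∃ P' ∈ localLayerPointsOfEmb κ (closureEmb (K := ℚ) (π.v.adicCompletion ℚ)) W (m - 1),
        ∃ R ∈ localLayerPointsOfEmb κ (closureEmb (K := ℚ) (π.v.adicCompletion ℚ)) W m, P = B + P' + 2 • R)
    (hgen0c : ∀ P ∈ localLayerPointsOfEmb κ (closureEmb (K := ℚ) (π.v.adicCompletion ℚ)) W 0,
      ∃ a : ℤ, ∃ R ∈ localLayerPointsOfEmb κ (closureEmb (K := ℚ) (π.v.adicCompletion ℚ)) W 0, P = a • dc 0 + 2 • R)
    (hdAc : ∀ m j, gc ^ j • dc m ∈ localTowerPointsOfEmb κ (closureEmb (K := ℚ) (π.v.adicCompletion ℚ)) W)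
    -- MTV_Λ at `μt` ALONG `(g_c, d_c)`
    (hMTc : ∃ (ν : padicCoeffIntegers (Set.range ι)) (w : IwasawaAlgebraO (Set.range ι)),
        ν ≠ 0 ∧ IsUnit w ∧
        ∀ m : ℕ, ∃ (k : ℕ) (q : IwasawaAlgebraO (Set.range ι)),
          PowerSeries.C ((2 : PadicAlgCl 2) ^ k) *
              (iwasawaOToPowerSeries (Set.range ι) μt *
                  (((mazurTateElementK g Ω 2 (2 * m)).map ι : (PadicAlgCl 2)[X]) : PowerSeries (PadicAlgCl 2)) -
                iwasawaOToPowerSeries (Set.range ι) (PowerSeries.C ν * w *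
                  e (fun i => ((∑ j ∈ Finset.range (2 ^ (2 * m)),
                    Polynomial.C (((π.locd₂ z).comp (AddMonoidHom.single
                      (fun _ : Fin n => ↥(localTowerPointsOfEmb κ (closureEmb (K := ℚ) (π.v.adicCompletion ℚ)) W)) i))
                      ⟨gc ^ j • dc (2 * m), hdAc (2 * m) j⟩) * (Polynomial.X + 1) ^ j : Polynomial ℤ_[2]) : PowerSeries ℤ_[2])))) =
            (((cyclotomicOmega 2 (2 * m)).map (Int.castRingHom (PadicAlgCl 2)) : (PadicAlgCl 2)[X]) : PowerSeries (PadicAlgCl 2)) *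
              iwasawaOToPowerSeries (Set.range ι) q) :
    ∃ (ν : padicCoeffIntegers (Set.range ι)) (u : IwasawaAlgebraO (Set.range ι)), ν ≠ 0 ∧ IsUnit u ∧
        PowerSeries.C ν * e (π.cvec z) = μt * (Lm * u) := by
  have hv2 : (2 : 𝓞 ℚ) ∈ π.v.asIdeal := by simpa using π.hv
  obtain ⟨col, hcong, hpin, hsurj, hker⟩ :=
    exists_colemanPlusHom_two_of_datum W hss κ hκ π.v hv2 gc hgc dc hdc htrc hgenc hgen0c hdAc ℤ_[2]
  exact hERL_of_mazurTateValues_along π z hL e he μt col gc dc hdAc hgc hdc hcong hpin hsurj hker hMTc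

end AtDatum

end Summit.BirchSwinnertonDyer.BirchSwinnertonDyer.Theorems.ThetaTransport.MazurTateValuesRelay

end
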